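import Summits.CriticalPhenomena.Ising3DConformalLimit.Theses.ReflectionTwin
import Summits.CriticalPhenomena.Ising3DConformalLimit.Theorems.HyperoctahedralRPLimitRotationInvariant
import Summits.CriticalPhenomena.Ising3DConformalLimit.Theorems.HyperoctahedralRPHRP2Rigidity
import HarnessLib

/-!
# Crux stmt-CriticalPhenomena-16913 `ReflectionTwin.TwinRotationGlue` — PROVED (the twin is not needed: items 1979 ∧ 1980)

Route `ReflectionTwin` (sub-problem `CriticalPhenomena/Ising3DConformalLimit`), bridge crux (rank 5): for every normalised,
continuous-off-the-diagonals, non-degenerate, translation-invariant, scale-covariant pointwise scaling limit `(ρ, Δ, S)` of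
`criticalCorr 3`, blind transparency of the `(111)` reflection twin implies `IsRotationInvariant S`. The conclusion already
follows from the first six hypotheses ALONE: the crux `HyperoctahedralRP.HRP2Rigidity` (item stmt-1979) is PROVED
(`Cruxes.HRP2Rigidity.XRayMellin.HRP2Rigidity_of`, `Theorems/HyperoctahedralRPHRP2Rigidity.lean`) and the crux
`HyperoctahedralRP.LimitRotationInvariant` (item stmt-1980, `HRP2Rigidity → … → IsRotationInvariant S`) is PROVED
(`Cruxes.LimitRotationInvariant.QuarterTurnLiouville.LimitRotationInvariant_of`,
`Theorems/HyperoctahedralRPLimitRotationInvariant.lean`); composing them gives `O(3)`-invariance of every such limit, so the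
twin antecedent is idle. The same composition closes the support item stmt-16909 `TwinTransfer` (`θ` is a linear
isometry). Found by the skeleton vet of this crux (refuter-skel-16913-vet, attached `TwinTransferFromTree.lean`) and landed
by the lead of line `Sketch` of this route's existence crux (stmt-4582). [folklore]
-/

noncomputable section

namespace Summit.CriticalPhenomena.Ising3DConformalLimit.ReflectionTwinTwinRotationGlue

open Literature.Probability.LatticeModels
open Summit.CriticalPhenomena.Ising3DConformalLimit.Cruxes.LimitRotationInvariant.QuarterTurnLiouville
  (LimitRotationInvariant_of)
open Summit.CriticalPhenomena.Ising3DConformalLimit.Cruxes.HRP2Rigidity.XRayMellin (HRP2Rigidity_of)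

/-- **Every normalised, non-degenerate, translation-invariant, scale-covariant pointwise scaling limit of the critical
`ℤ³` Ising correlators is `O(3)`-invariant** (items 1979 ∧ 1980, composed). [folklore] -/
theorem isRotationInvariant_of_limit (ρ : ℝ → ℝ) (Δ : ℝ) (S : CorrFamily 3)
    (hρ : ∀ δ ∈ Set.Ioc (0:ℝ) 1, 0 < ρ δ) (hlim : HasPointwiseScalingLimit (criticalCorr 3) ρ S)
    (hnorm : ∀ n z, z ∉ NonCoincident 3 n → S n z = 0) (hnd : IsNondegenerateTwoPoint S)
    (htr : IsTranslationInvariant S) (hsc : IsScaleCovariant Δ S) : IsRotationInvariant S :=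
  LimitRotationInvariant_of HRP2Rigidity_of ρ Δ S hρ hlim hnorm hnd htr hsc

/-- **Crux stmt-CriticalPhenomena-16913 `TwinRotationGlue` — proved** (the twin hypothesis is not used). [folklore] -/
theorem twinRotationGlue_proof :
    Summit.CriticalPhenomena.Ising3DConformalLimit.Theses.ReflectionTwin.TwinRotationGlue := by
  intro ρ Δ S hρ hlim hnorm _hcont hnd htr hsc _hex
  exact isRotationInvariant_of_limit ρ Δ S hρ hlim hnorm hnd htr hsc

end Summit.CriticalPhenomena.Ising3DConformalLimit.ReflectionTwinTwinRotationGlue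

end
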